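import Summits.QuantumFields.YangMills.Theorems.BalabanUVNodesN08KFoldTransportEnvelopeT3
import Summits.QuantumFields.YangMills.Theorems.UV3PinnedStepOrganOfTopPartialIterates
import HarnessLib

/-!
# R3 (cell `ym3-torus`, YM₃ on T³ — a ladder RUNG, NOT d = 4, NOT infinite volume, NOT a mass gap, NOT the Clay problem) —
# **THE TOP-LEVEL LETTER hTop INHABITS THE N08 SEAT's PER-START CLOSED FAMILY AT `avT3`, WITH EQUALITY BELOW THE CAP; hence in the v3
# currency (pinned masses `MassesPAC.massRecP`, trivial history EXACTLY `1`, no floor) hTop gives the FLAT envelope `massRecP_K(r,·) ≤ e^{c}` a.e. —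
# no factor `K + 1`**

Width seat `ym3-torus-px8` g12 on crux `stmt-QuantumFields-19936` `UnitScaleTilt.HistoryTailL` (`--supports`, helper; THEOREMS ONLY, 0 `def`, 0 `sorry`).
Companion of `ym-ust-19936-w3` g19's ✓`UV3PinnedStepOrganOfTopPartialIterates` (K-21-TOP: in the v1 currency `MassesAC.massRecAC`, floored at the trivial
history, hTop gives the LINEAR envelope `(K+1)·e^{c}`) and of `dag-n08-d` g47's ✓`BalabanUVNodesN08KFoldTransportEnvelopeT3` (§2: a per-start closed family
`μ j k` with a K-uniform top cap dominates the PINNED masses of every history, flat).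

THE POINT.  g47's v3 hypothesis at the family's pinned block averaging `avT3 F K` (= `blockAvg ℰp` in range) reads, per run `K`:
`∃ μ : ℕ → ∀ k, Measure`, (start) `(dU_j)∘Ū_j⁻¹ ≤ μ j (j+1)`, (step) `(μ j k)∘Ū_k⁻¹ ≤ μ j (k+1)` (`j < k < K`), (cap) `μ j K ≤ e^{A₁}·dU_K` (`j < K`).
The canonical partial iterated push-forwards of Haar `ι_{j,k} = (Ū_{k−1}∘⋯∘Ū_j)_*dU_j` (pub-ymgap N08 file 27 ✓`exists_partialIterates`: `ι_{j,j} = dU_j`,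
`ι_{j,k+1} = ι_{j,k}∘Ū_k⁻¹`; no definition introduced) satisfy (start) and (step) WITH EQUALITY, and `ι_{j,j+n} = (dU_j)∘(iterFrom av j n)⁻¹` (K-21-TOP §2
✓`partialIterates_eq_map_iterFrom`), so (cap) is EXACTLY the top-level letter

  hTop(F) : `∃ c ≥ 0, ∀ K j n, j + n = K → (dU_j^{(K)})∘(iterFrom (avT3 F K) j n)⁻¹ ≤ e^{c}·dU_{j+n}^{(K)}`

(w3 g19's K-23-TOP binder, ★★OWNER WORD 68's v5-candidate letter, VERBATIM).  Hence (§1, generic `P`, `G`, any averaging family with `AvgAC`)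
`startClosed_of_map_iterFrom_le_top` and the FLAT a.e. bound `massRecP_le_exp_ae_of_map_iterFrom_le_top` (`massRecP_K(h,·) ≤ e^{c}`, EVERY history — g47's
✓`massRecP_le_exp_ae_of_startClosed` at the canonical family); (§2, at the lane, per family `F`) `startClosed_avT3_of_topHaarPushforward` (hTop(F) ⟹ g47's
`hN08` binder of ✓`massRecP_avT3_le_exp_ae_of_startClosed` VERBATIM, `A₁ := c`) and `massRecP_avT3_le_exp_ae_of_topHaarPushforward` (hTop(F) ⟹
`massRecP … (avT3 F K) K r ≤ e^{A₁}` `dU_K`-a.e., every run, every history, all carrier parameters) — the v3 twin of K-21-TOP §3 without the `K + 1`.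
WHY v3 IS FLAT AND v1 IS NOT: v1's `massRecAC` floors the trivial history's mass at `1` at EVERY level (`max 1 (T[…])`), and the floors stack into the
`Σ_{j<k} ι_{j,k}` family (K-21-TOP §1: `1 + k·C`); v3's `massRecP` has `massRecP(triv) = 1` on the nose (`MassesPAC.massRecP_triv`), so a non-trivial history is
dominated from its FIRST non-trivial level `j` by the single member `ι_{j,k}` (g47's §2 induction) and only the cap at the target level is spent.

HONEST SCOPE.  [folklore] measure bookkeeping over landed theorems; hTop is DISPLAYED (a hypothesis), NOT proved — for the tree's `blockAvg ℰp` it is OPEN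
(the one-step image law is not Haar; the K-uniform constant is the N08 seat's laundering∕polymer bound (β), not in the tree); the junction from
`massRecP … (avT3 F K)` to the 19936 registered row's letter hJ(v3) (`PinnedStep.massP` at the v3 package) is NOT in this file (★★OWNER WORD 72: one pen,
`ym-ust-19936-w6`); nothing of hJ(v3), `stub_pinnedStep`, `stub_unitEnvelope`, `hP′`, `HistoryTailL` (19936), the rung `YM3TorusSU2`, any continuum limit,
d = 4, a mass gap or Clay is proved here.  YM₃ on T³ is rung R3 of the ladder, not the Clay problem.

References: T. Bałaban, Commun. Math. Phys. **102** (1985) 255–275 [Balaban1985UV3] ((41) p. 266, (48) p. 268, (2) p. 256, (5) p. 257);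
T. Bałaban, Commun. Math. Phys. **98** (1985) 17–51 [Balaban1985Averaging] ((10), (15) p. 19); T. Bałaban, Commun. Math. Phys. **109** (1987) 249–301
[Balaban1987RG1] ((0.11) p. 253, the iterated averagings).
-/

set_option autoImplicit false

noncomputable section

open MeasureTheory
open scoped ENNReal

namespace Summit.QuantumFields.YangMills.Theorems.UV3StartClosedOfTopHaarPushforward

open Literature.MathematicalPhysics.QuantumFieldTheory.Balaban1983to89
open Literature.MathematicalPhysics.QuantumFieldTheory.Balaban1983to89.T4AvgSensitivity (iterFrom)
open Literature.MathematicalPhysics.QuantumFieldTheory.Balaban1983to89.T4SeparableFibreExpansion (measurable_iterFrom)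
open Summit.QuantumFields.Balaban3D.Carriers
open Summit.QuantumFields.Balaban3D.Proofs.MassesPAC
open Summit.QuantumFields.YangMills.BalabanUVNodes.N08PartialIteratesSufficiency (exists_partialIterates)
open Summit.QuantumFields.YangMills.Theorems.UV3PinnedStepOrganOfTopPartialIterates (partialIterates_eq_map_iterFrom)
open Summit.QuantumFields.YangMills.Theorems.BalabanUVNodesN08KFoldTransportEnvelopeT3
  (massRecP_le_exp_ae_of_startClosed massRecP_avT3_le_exp_ae_of_startClosed)

/-! ## §1 Generic: the canonical partial iterates are a per-start closed family, closed with equality; the cap is the top-level letter -/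
section Generic

variable {P : Params} {G : Type} [GaugeGroup G] [MeasurableSpace G] [HaarData G]
  (av : ∀ j, Averaging P j G) (hav : ∀ j, AvgAC (av j).avg)
include hav

/-- ★ **THE CANONICAL PER-START FAMILY, CLOSED WITH EQUALITY**: there is a two-parameter family `μ j k` of measures on the level-`k` fields with
`(dU_j)∘Ū_j⁻¹ = μ j (j+1)`, `(μ j k)∘Ū_k⁻¹ = μ j (k+1)` for `j ≤ k`, and `μ j (j+n) = (dU_j)∘(Ū_{j+n−1}∘⋯∘Ū_j)⁻¹` — the partial iterated push-forwards of
Haar of pub-ymgap N08 file 27 (✓`exists_partialIterates`), read along the composite averaging `iterFrom` (✓`partialIterates_eq_map_iterFrom`).  No definition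
introduced. [cite: Balaban1985UV3, (2) p.256 (bookkeeping); Balaban1987RG1, (0.11) p.253] -/
theorem exists_startClosed_eq :
    ∃ μ : ℕ → ∀ k, Measure (GaugeField P k G),
      (∀ j, (fieldMeasure P j G).map (av j).avg = μ j (j + 1)) ∧
      (∀ j k, j ≤ k → (μ j k).map (av k).avg = μ j (k + 1)) ∧
      (∀ j n, μ j (j + n) = (fieldMeasure P j G).map (iterFrom av j n)) := by
  obtain ⟨ι, hι0, hιs⟩ := exists_partialIterates av
  refine ⟨ι, fun j => ?_, fun j k hjk => (hιs j k hjk).symm, fun j n => partialIterates_eq_map_iterFrom av hav ι hι0 hιs j n⟩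
  rw [hιs j j le_rfl, hι0 j]

/-- ★★ **THE TOP-LEVEL LETTER INHABITS THE PER-START CLOSED FAMILY WITH A TOP CAP** (the hypothesis shape of `dag-n08-d`'s
✓`massRecP_le_exp_ae_of_startClosed`): if every segment of the averaging ENDING AT LEVEL `K̄` pushes Haar to at most `C`·Haar,
`(dU_j)∘(iterFrom av j n)⁻¹ ≤ C·dU_{j+n}` whenever `j + n = K̄`, then the canonical family of `exists_startClosed_eq` satisfies (start), (step) — with equality —
and (cap) `μ j K̄ ≤ C·dU_{K̄}` for every `j < K̄`.  Nothing is asked at the levels `k < K̄`. [cite: Balaban1985UV3, (2) p.256 + (5) p.257 (bookkeeping); Balaban1987RG1, (0.11) p.253] -/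
theorem startClosed_of_map_iterFrom_le_top (Kt : ℕ) (C : ℝ≥0∞)
    (htop : ∀ j n : ℕ, j + n = Kt → (fieldMeasure P j G).map (iterFrom av j n) ≤ C • fieldMeasure P (j + n) G) :
    ∃ μ : ℕ → ∀ k, Measure (GaugeField P k G),
      (∀ j, j < Kt → (fieldMeasure P j G).map (av j).avg ≤ μ j (j + 1)) ∧
      (∀ j k, j < k → k < Kt → (μ j k).map (av k).avg ≤ μ j (k + 1)) ∧
      (∀ j, j < Kt → μ j Kt ≤ C • fieldMeasure P Kt G) := by
  obtain ⟨μ, hstart, hstep, hiter⟩ := exists_startClosed_eq av hav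
  refine ⟨μ, fun j _ => (hstart j).le, fun j k hjk _ => (hstep j k hjk.le).le, fun j hj => ?_⟩
  obtain ⟨n, rfl⟩ : ∃ n, Kt = j + n := ⟨Kt - j, by omega⟩
  rw [hiter j n]
  exact htop j n rfl

/-- ★★ **THE FLAT a.e. ENVELOPE OF THE PINNED MASSES FROM THE TOP-LEVEL LETTER — NO `K̄ + 1`**: if every segment ending at level `K̄` pushes Haar to
`≤ e^{c}`·Haar (`c ≥ 0`), then `massRecP_{K̄}(h, V) ≤ e^{c}` for `dU_{K̄}`-a.e. `V` and EVERY history `h` (trivial: mass `1 ≤ e^{c}`; inadmissible: `0`) —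
`dag-n08-d`'s ✓`massRecP_le_exp_ae_of_startClosed` at the canonical family of `startClosed_of_map_iterFrom_le_top`.  Contrast the v1 currency, where the same
letter gives only `massRecAC ≤ (K̄+1)·e^{c}` (✓`UV3PinnedStepOrganOfTopPartialIterates.massRecAC_le_lin_exp_ae_of_map_iterFrom_le`): the pinned masses carry no
floor at the trivial history, so nothing stacks. [cite: Balaban1985UV3, (41) p.266 + (48) p.268 + (2) p.256 (the masses; bookkeeping); Balaban1987RG1, (0.11) p.253] -/
theorem massRecP_le_exp_ae_of_map_iterFrom_le_top (M₁ : ℕ) (Rcol : ℕ → ℕ) (εL εS : ℕ → ℝ) (Kt : ℕ) (c : ℝ) (hc : 0 ≤ c)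
    (htop : ∀ j n : ℕ, j + n = Kt →
      (fieldMeasure P j G).map (iterFrom av j n) ≤ ENNReal.ofReal (Real.exp c) • fieldMeasure P (j + n) G)
    (h : Hist P Kt) :
    ∀ᵐ V ∂(fieldMeasure P Kt G), massRecP M₁ Rcol εL εS av Kt h V ≤ Real.exp c := by
  obtain ⟨μ, hstart, hstep, hcap⟩ := startClosed_of_map_iterFrom_le_top av hav Kt (ENNReal.ofReal (Real.exp c)) htop
  exact massRecP_le_exp_ae_of_startClosed M₁ Rcol εL εS av hav Kt μ hstart hstep hc hcap h

end Generic

/-! ## §2 At the lane: hTop(F) inhabits the N08 seat's v3 hypothesis at `avT3 F K`, and bounds the pinned masses flat -/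
section Lane

open Literature.MathematicalPhysics.QuantumFieldTheory.Balaban1983to89.T3ContinuumYM3Torus
open Literature.MathematicalPhysics.QuantumFieldTheory.Balaban1983to89.T3UnitLawDensityEML (ℰp)
open Literature.MathematicalPhysics.QuantumFieldTheory.Balaban1985CMP102
open Literature.MathematicalPhysics.QuantumFieldTheory.Balaban1985CMP102.Setting
open Summit.QuantumFields.YangMills.Theorems.UV3PinnedStepOrganOfTopPartialIterates (iterFrom_avT3_eq_iterFrom_blockAvg)

variable (F : T3Family)

/-- ★★ **hTop(F) ⟹ THE N08 SEAT's v3 HYPOTHESIS AT `avT3`, VERBATIM** (the `hN08` binder of `dag-n08-d`'s ✓`massRecP_avT3_le_exp_ae_of_startClosed`, with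
`A₁ := c`): per family, IF there is `c ≥ 0` such that at every run `K` every segment of the pinned block averaging `avT3 F K` ENDING AT THE UNIT TORUS pushes
Haar to at most `e^{c}`·Haar, THEN at every run the canonical per-start family is (start)∕(step)-closed and capped by `e^{c}·dU_K` at the top — §1 at
✓`avgAC_avT3`.  hTop is w3 g19's K-23-TOP letter (★★OWNER WORD 68), unchanged. [cite: Balaban1985UV3, (2) p.256 + (5) p.257 (bookkeeping); Balaban1985Averaging, (15) p.19; Balaban1987RG1, (0.11) p.253] -/
theorem startClosed_avT3_of_topHaarPushforward
    (hTop : ∃ c : ℝ, 0 ≤ c ∧ ∀ (K j n : ℕ), j + n = K →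
      (fieldMeasure (F.P K) j (Matrix.specialUnitaryGroup (Fin 2) ℂ)).map (iterFrom (avT3 F K) j n) ≤
        ENNReal.ofReal (Real.exp c) • fieldMeasure (F.P K) (j + n) (Matrix.specialUnitaryGroup (Fin 2) ℂ)) :
    ∃ A₁ : ℝ, 0 ≤ A₁ ∧ ∀ K : ℕ, ∃ μ : ℕ → ∀ k, Measure (GaugeField (F.P K) k (Matrix.specialUnitaryGroup (Fin 2) ℂ)),
      (∀ j, j < K → (fieldMeasure (F.P K) j _).map (avT3 F K j).avg ≤ μ j (j + 1)) ∧
      (∀ j k, j < k → k < K → (μ j k).map (avT3 F K k).avg ≤ μ j (k + 1)) ∧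
      (∀ j, j < K → μ j K ≤ ENNReal.ofReal (Real.exp A₁) • fieldMeasure (F.P K) K _) := by
  obtain ⟨c, hc0, hc⟩ := hTop
  exact ⟨c, hc0, fun K => startClosed_of_map_iterFrom_le_top (avT3 F K) (avgAC_avT3 F K) K (ENNReal.ofReal (Real.exp c))
    fun j n hjn => hc K j n hjn⟩

/-- ★★ **THE FLAT ENVELOPE OF THE PINNED MASSES OF `avT3` FROM hTop — EVERY RUN, EVERY HISTORY, ALL CARRIER PARAMETERS, NO `K + 1`**:
`massRecP M₁ Rcol εL εS (avT3 F K) K r W ≤ e^{A₁}` for `dU_K`-a.e. `W` (`dag-n08-d`'s ✓`massRecP_avT3_le_exp_ae_of_startClosed` ∘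
`startClosed_avT3_of_topHaarPushforward`).  The 19936 registered row's letter hJ(v3) reads these masses at the v3 package's lane parameters
(`PinnedStep.massP 𝔠.lane (h.pkgAtV3 …).X K r W`, whose averaging is `avT3 F K` by `XT3_av`); that junction is the WORD-72 pen's, not this file's.
[cite: Balaban1985UV3, (41) p.266 + (48) p.268 + (2) p.256 (the masses; bookkeeping); Balaban1985Averaging, (15) p.19; Balaban1987RG1, (0.11) p.253] -/
theorem massRecP_avT3_le_exp_ae_of_topHaarPushforward
    (hTop : ∃ c : ℝ, 0 ≤ c ∧ ∀ (K j n : ℕ), j + n = K →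
      (fieldMeasure (F.P K) j (Matrix.specialUnitaryGroup (Fin 2) ℂ)).map (iterFrom (avT3 F K) j n) ≤
        ENNReal.ofReal (Real.exp c) • fieldMeasure (F.P K) (j + n) (Matrix.specialUnitaryGroup (Fin 2) ℂ)) :
    ∃ A₁ : ℝ, 0 ≤ A₁ ∧ ∀ (K : ℕ) (M₁ : ℕ) (Rcol : ℕ → ℕ) (εL εS : ℕ → ℝ) (r : Hist (F.P K) K),
      ∀ᵐ W ∂(fieldMeasure (F.P K) K (Matrix.specialUnitaryGroup (Fin 2) ℂ)), massRecP M₁ Rcol εL εS (avT3 F K) K r W ≤ Real.exp A₁ := by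
  obtain ⟨c, hc0, hc⟩ := hTop
  exact ⟨c, hc0, fun K M₁ Rcol εL εS r =>
    massRecP_le_exp_ae_of_map_iterFrom_le_top (avT3 F K) (avgAC_avT3 F K) M₁ Rcol εL εS K c hc0 (fun j n hjn => hc K j n hjn) r⟩

/-- ★ **THE SAME WITH THE CRUXES' `blockAvg ℰp` FAMILY SPELLED OUT** in the hypothesis (`iterFrom (avT3 F K) j n = iterFrom (fun i ↦ blockAvg ℰp) j n` for
`j + n = K ≤ m + K`, K-21-TOP ✓`iterFrom_avT3_eq_iterFrom_blockAvg`). [cite: Balaban1985UV3, (41) p.266 + (2) p.256; Balaban1987RG1, (0.4) + (0.11) p.253] -/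
theorem massRecP_avT3_le_exp_ae_of_topBlockAvgPushforward
    (hTopB : ∃ c : ℝ, 0 ≤ c ∧ ∀ (K j n : ℕ), j + n = K →
      (fieldMeasure (F.P K) j (Matrix.specialUnitaryGroup (Fin 2) ℂ)).map
          (iterFrom (fun i => BlockAveraging.blockAvg (P := F.P K) (G := Matrix.specialUnitaryGroup (Fin 2) ℂ) (j := i) ℰp) j n) ≤
        ENNReal.ofReal (Real.exp c) • fieldMeasure (F.P K) (j + n) (Matrix.specialUnitaryGroup (Fin 2) ℂ)) :
    ∃ A₁ : ℝ, 0 ≤ A₁ ∧ ∀ (K : ℕ) (M₁ : ℕ) (Rcol : ℕ → ℕ) (εL εS : ℕ → ℝ) (r : Hist (F.P K) K),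
      ∀ᵐ W ∂(fieldMeasure (F.P K) K (Matrix.specialUnitaryGroup (Fin 2) ℂ)), massRecP M₁ Rcol εL εS (avT3 F K) K r W ≤ Real.exp A₁ := by
  obtain ⟨c, hc0, hc⟩ := hTopB
  refine massRecP_avT3_le_exp_ae_of_topHaarPushforward F ⟨c, hc0, fun K j n hjn => ?_⟩
  rw [iterFrom_avT3_eq_iterFrom_blockAvg F K j n (by omega)]
  exact hc K j n hjn

end Lane

end Summit.QuantumFields.YangMills.Theorems.UV3StartClosedOfTopHaarPushforward

end
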